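import Literature.Computability.Cryptography.ComPRGHiding
import Literature.Computability.Cryptography.HybridSamplingMachine
import HarnessLib

/-!
# A pseudorandom generator from a bit-commitment scheme, VI: the hiding reduction is polynomial-time

Topic `Literature/Computability/Cryptography`; sequel of `ComPRGHiding.lean`, which proves Step 2 of the proof of
M. Luby, *Pseudorandomness and Cryptographic Applications* (1996), Lecture 10, Thm. 10.3 for the false-entropy
generator of a bit-commitment scheme (the extreme hybrids `X S 0`, `X S t` are computationally indistinguishable)
from the hypothesis that the reduction `DH D (clH D)` runs in probabilistic polynomial time. This file discharges
that hypothesis ("Clearly, `D'` can be implemented in probabilistic polynomial time", Goldreich 2001, proof of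
Thm. 3.2.6): an `FP` program `dhF D` — decode the advice `(pos, ρ, j, κ)` from the coin count by three unary
divisions, parse the coins, plant the challenge in the hybrid tuple (a `foldCat` whose body compares the block index
with `pos`), hash, run the machine of `D` (`Hybrid.distFn_mem_FP`) and XOR its verdict with the guessed bit —
computes `dhRun D` on every input (`dhF_boolPair`), and the budget `clH D` is polynomially bounded (`clH_le`);
hence `isPPT_DH` and the unconditional form **`isCompIndistinguishable_hybrids`** of the hiding step.
All proved; no named facts.

## References

* M. Luby, *Pseudorandomness and Cryptographic Applications*, Princeton University Press 1996, Lecture 10,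
  Thm. 10.3 (proof, Step 2).
* O. Goldreich, *Foundations of Cryptography I*, CUP 2001, Thm. 3.2.6 (proof), §1.3.2 (PPT machines).
* S. Arora, B. Barak, *Computational Complexity: A Modern Approach*, CUP 2009, §1.3 (machine composition).
-/

namespace Literature.Computability.Cryptography

open _root_.Computability Complexity Complexity.Brick Complexity.Plumb Complexity.BitCodec Polynomial Hybrid AffineStr
  Finset RepSampI PRGStretch Filter Asymptotics

namespace ComPRG

namespace Setup

variable (S : Setup)

/-! ### The bricks of the reduction (input `q = ⟨inp, r⟩`, `inp = ⟨u, c'⟩`, `n = |u|`) -/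

section Bricks

/-- `u` (the level in unary, handed on to `D`). [folklore] -/
noncomputable def quF : List Bool → List Bool := fstF ∘ fstF
/-- The challenge `c'`. [folklore] -/
noncomputable def qcF : List Bool → List Bool := sndF ∘ fstF
/-- The guessed bit `[v]` (first coin). [folklore] -/
noncomputable def qvF : List Bool → List Bool := HashBricks.headBitFn ∘ sndF
/-- `1^{|r|}`. [folklore] -/
noncomputable def qLU : List Bool → List Bool := onesFn ∘ sndF
/-- `⟨1^{|r| / t}, 1^{pos}⟩`. [folklore] -/
noncomputable def d1F : List Bool → List Bool := divModFn ∘ fanoutFn (S.tU ∘ quF) qLU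
/-- `1^{pos}`. [folklore] -/
noncomputable def qposU : List Bool → List Bool := sndF ∘ S.d1F
/-- `⟨1^{|r| / t / (J+1)}, 1^{ρ}⟩`. [folklore] -/
noncomputable def d2F : List Bool → List Bool := divModFn ∘ fanoutFn (S.L0U ∘ quF) (fstF ∘ S.d1F)
/-- `1^{ρ}`. [folklore] -/
noncomputable def qrhoU : List Bool → List Bool := sndF ∘ S.d2F
/-- `1^{4 L0 + 1}` from `u`. [folklore] -/
noncomputable def L4U : List Bool → List Bool := fun u => S.L0U u ++ (S.L0U u ++ (S.L0U u ++ (S.L0U u ++ [true])))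
/-- `⟨1^{Q}, 1^{j}⟩`. [folklore] -/
noncomputable def d3F : List Bool → List Bool := divModFn ∘ fanoutFn (S.L4U ∘ quF) (fstF ∘ S.d2F)
/-- `1^{j}`. [folklore] -/
noncomputable def qjU : List Bool → List Bool := sndF ∘ S.d3F
/-- `1^{Q}`. [folklore] -/
noncomputable def qQU : List Bool → List Bool := fstF ∘ S.d3F
/-- `1^{idxOf n ρ j}` (the synthetic candidate index). [folklore] -/
noncomputable def idxHU : List Bool → List Bool := fun q => S.qrhoU q ++ HashBricks.umulFn (boolPair (S.L0U (quF q)) (S.qjU q))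
/-- The synthetic sampler input `⟨u, ⟨1^{idxOf n ρ j}, []⟩⟩` (to reuse `m1U`, `m2U`). [folklore] -/
noncomputable def synF : List Bool → List Bool := fanoutFn quF (fanoutFn S.idxHU fun _ => [])
/-- `1^{m1 n j}`. [folklore] -/
noncomputable def qm1U : List Bool → List Bool := S.m1U ∘ S.synF
/-- `1^{m2 n j}`. [folklore] -/
noncomputable def qm2U : List Bool → List Bool := S.m2U ∘ S.synF
/-- `1^{rLen n}` from `u`. [folklore] -/
noncomputable def rLenU : List Bool → List Bool := HashBricks.umulFn ∘ fanoutFn S.tU (List.cons true ∘ S.L0U)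
/-- `1^{dhBody n j}`. [folklore] -/
noncomputable def bodyU : List Bool → List Bool := fun q =>
  true :: (S.K1U (quF q) ++ (S.K2U (quF q) ++ (S.rLenU (quF q) ++ S.qm2U q)))
/-- `1^{κ}` (`κ = Q − dhBody n j`). [folklore] -/
noncomputable def qkapU : List Bool → List Bool := dropFn ∘ fanoutFn S.bodyU S.qQU
/-- The coins handed to `D`: `(r ⇂ dhBody) ↾ κ`. [folklore] -/
noncomputable def dcoinsF : List Bool → List Bool := takeFn ∘ fanoutFn S.qkapU (dropFn ∘ fanoutFn S.bodyU sndF)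
/-- `r ⇂ 1`. [folklore] -/
noncomputable def r1HF : List Bool → List Bool := dropFn ∘ fanoutFn (fun _ => [true]) sndF
/-- `κ₁`. [folklore] -/
noncomputable def qk1F : List Bool → List Bool := takeFn ∘ fanoutFn (S.K1U ∘ quF) r1HF
/-- `r ⇂ 1 ⇂ K1`. [folklore] -/
noncomputable def rest1F : List Bool → List Bool := dropFn ∘ fanoutFn (S.K1U ∘ quF) r1HF
/-- `κ₂`. [folklore] -/
noncomputable def qk2F : List Bool → List Bool := takeFn ∘ fanoutFn (S.K2U ∘ quF) S.rest1F
/-- `r ⇂ 1 ⇂ K1 ⇂ K2`. [folklore] -/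
noncomputable def rest2F : List Bool → List Bool := dropFn ∘ fanoutFn (S.K2U ∘ quF) S.rest1F
/-- The block coins `R`. [folklore] -/
noncomputable def qRF : List Bool → List Bool := takeFn ∘ fanoutFn (S.rLenU ∘ quF) S.rest2F
/-- `u₂`. [folklore] -/
noncomputable def qu2F : List Bool → List Bool := takeFn ∘ fanoutFn S.qm2U (dropFn ∘ fanoutFn (S.rLenU ∘ quF) S.rest2F)
/-- The planted coded pair `c' ‖ v`. [folklore] -/
noncomputable def cvF : List Bool → List Bool := fun q => qcF q ++ qvF q
/-- The fold context `⟨⟨⟨1ⁿ, 1^ρ⟩, ⟨1^{pos}, c' ‖ v⟩⟩, R⟩`. [folklore] -/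
noncomputable def ctxHF : List Bool → List Bool :=
  fanoutFn (fanoutFn (fanoutFn (onesFn ∘ quF) S.qrhoU) (fanoutFn S.qposU cvF)) S.qRF

/-! Inside the fold body (`z' = ⟨ctx, 1^ℓ⟩`). -/

/-- `1ⁿ`. [folklore] -/
noncomputable def hnU : List Bool → List Bool := fstF ∘ fstF ∘ fstF ∘ fstF
/-- `1^ρ`. [folklore] -/
noncomputable def hrhoU : List Bool → List Bool := sndF ∘ fstF ∘ fstF ∘ fstF
/-- `1^{pos}`. [folklore] -/
noncomputable def hposU : List Bool → List Bool := fstF ∘ sndF ∘ fstF ∘ fstF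
/-- `c' ‖ v`. [folklore] -/
noncomputable def hcvF : List Bool → List Bool := sndF ∘ sndF ∘ fstF ∘ fstF
/-- `R`. [folklore] -/
noncomputable def hRF : List Bool → List Bool := sndF ∘ fstF
/-- `1^ℓ`. [folklore] -/
noncomputable def hlU : List Bool → List Bool := sndF
/-- `1^{L0 + 1}`. [folklore] -/
noncomputable def hL1U : List Bool → List Bool := List.cons true ∘ S.L0U ∘ hnU
/-- The block `y_ℓ = (R ⇂ ℓ(L0+1)) ↾ (L0+1)`. [folklore] -/
noncomputable def hblkF : List Bool → List Bool :=
  takeFn ∘ fanoutFn S.hL1U (dropFn ∘ fanoutFn (HashBricks.umulFn ∘ fanoutFn hlU S.hL1U) hRF)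
/-- `[b_ℓ]`. [folklore] -/
noncomputable def hbitF : List Bool → List Bool := HashBricks.headBitFn ∘ S.hblkF
/-- `r_ℓ ↾ ρ`. [folklore] -/
noncomputable def hcoinF : List Bool → List Bool := takeFn ∘ fanoutFn hrhoU (dropFn ∘ fanoutFn (fun _ => [true]) S.hblkF)
/-- The fresh bit `[u_ℓ]` (bit `L0` of the block). [folklore] -/
noncomputable def hfreshF : List Bool → List Bool := HashBricks.headBitFn ∘ dropFn ∘ fanoutFn (S.L0U ∘ hnU) S.hblkF
/-- `[pos ≤ ℓ]`. [folklore] -/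
noncomputable def hgeF : List Bool → List Bool := isNilFn ∘ dropFn ∘ fanoutFn hlU hposU
/-- `[ℓ ≤ pos]`. [folklore] -/
noncomputable def hleF : List Bool → List Bool := isNilFn ∘ dropFn ∘ fanoutFn hposU hlU
/-- The revealed bit: `b_ℓ` from `pos` on, the fresh bit before. [cite: Goldreich2001, §3.2.3 (hybrid distributions)] -/
noncomputable def hrevF : List Bool → List Bool := iteFn hgeF S.hbitF S.hfreshF
/-- `commit(1ⁿ, b_ℓ; r_ℓ ↾ ρ)`. [cite: Goldreich2001, Def. 4.4.1] -/
noncomputable def hcomF : List Bool → List Bool := comB S.C ∘ fanoutFn hnU (fanoutFn S.hbitF S.hcoinF)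
/-- `1^{Qc n}`. [folklore] -/
noncomputable def hQcU : List Bool → List Bool := S.QcU ∘ hnU
/-- The header `(1^{|c|} 0^{Qc}) ↾ Qc`. [folklore] -/
noncomputable def hhdrF : List Bool → List Bool :=
  takeFn ∘ fanoutFn S.hQcU (fun z => onesFn (S.hcomF z) ++ Kannan.zerosFn (S.hQcU z))
/-- The body `(c 0^{Qc}) ↾ Qc`. [folklore] -/
noncomputable def hbdyF : List Bool → List Bool :=
  takeFn ∘ fanoutFn S.hQcU (fun z => S.hcomF z ++ Kannan.zerosFn (S.hQcU z))
/-- The coded pair at a non-planted position. [cite: Goldreich2001, Thm. 3.2.6 (proof)] -/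
noncomputable def hpieceNF : List Bool → List Bool := fun z => S.hhdrF z ++ (S.hbdyF z ++ S.hrevF z)
/-- **The fold body**: the planted pair at `ℓ = pos`, the coded pair of block `ℓ` elsewhere.
[cite: Goldreich2001, Thm. 3.2.6 (proof, algorithm D')] -/
noncomputable def hpieceF : List Bool → List Bool := iteFn hgeF (iteFn hleF hcvF S.hpieceNF) S.hpieceNF
/-- **The planted tuple as a fold.** [cite: Goldreich2001, Thm. 3.2.6 (proof, algorithm D')] -/
noncomputable def zPlantF : List Bool → List Bool :=
  foldCat (Polynomial.X + S.LzP) S.tP S.hpieceF ∘ fanoutFn S.ctxHF (S.tU ∘ quF)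
/-- `h¹_{κ₁}(zPlant)` to `m1 n j` bits. [cite: Luby1996, Lecture 10, Theorem 10.3 (`h_{y'}`)] -/
noncomputable def qh1F : List Bool → List Bool :=
  AffineProg.hashFn ∘ fanoutFn (fanoutFn (S.tLzU ∘ quF) S.qm1U) (fanoutFn S.qk1F S.zPlantF)
/-- `1^{xLen + 1}`. [folklore] -/
noncomputable def xL1U : List Bool → List Bool := List.cons true ∘ S.xLenU ∘ quF
/-- The clamped payload. [folklore] -/
noncomputable def qpayF : List Bool → List Bool :=
  takeFn ∘ fanoutFn S.xL1U (fun q => S.qh1F q ++ (S.qu2F q ++ Kannan.zerosFn (S.xL1U q)))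
/-- The sample handed to `D`. [cite: Luby1996, Lecture 10, Theorem 10.3 (proof, Step 2)] -/
noncomputable def sampleF : List Bool → List Bool := fun q => S.qk1F q ++ (S.qk2F q ++ S.qpayF q)
/-- `⟨⟨u, sample⟩, coins of D⟩`. [folklore] -/
noncomputable def dInF : List Bool → List Bool := fanoutFn (fanoutFn quF S.sampleF) S.dcoinsF
/-- `[D(⟨u, sample⟩; coins)]` (the machine of `D` read as a string function). [cite: Goldreich2001, Thm. 3.2.6 (proof)] -/
noncomputable def dOutF (D : RandAlg (List Bool) Bool) : List Bool → List Bool :=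
  (fun q => encodeBool (D.run (fstF q) (sndF q))) ∘ S.dInF
/-- **The program of the reduction**: `D`'s verdict XOR the guessed bit. [cite: Luby1996, Lecture 10, Theorem 10.3 (proof, Step 2)] -/
noncomputable def dhF (D : RandAlg (List Bool) Bool) : List Bool → List Bool := HashBricks.xorFn (S.dOutF D) qvF

end Bricks

variable {S}

/-! ### Unary helpers -/

section Helpers

/-- `ones a ‖ ones b = ones (a + b)`. [folklore] -/
private theorem ones_appendH (a b : ℕ) : ones a ++ ones b = ones (a + b) := by
  rw [ones, ones, ones, List.replicate_append_replicate]
/-- `ones a ‖ [1] = ones (a + 1)`. [folklore] -/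
private theorem ones_append_trueH (a : ℕ) : ones a ++ [true] = ones (a + 1) := by
  rw [ones, ones, List.replicate_succ']
/-- `1 :: ones a = ones (a + 1)`. [folklore] -/
private theorem true_cons_onesH (a : ℕ) : true :: ones a = ones (a + 1) := by
  rw [ones, ones, List.replicate_succ]
/-- `|ones a| = a`. [folklore] -/
private theorem length_onesH (a : ℕ) : (ones a).length = a := List.length_replicate ..
/-- Unary subtraction. [folklore] -/
private theorem drop_onesH (a b : ℕ) : dropFn (boolPair (ones a) (ones b)) = ones (b - a) := by
  rw [dropFn_boolPair, length_onesH, ones, ones, List.drop_replicate]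
/-- `onesFn u = ones |u|`. [folklore] -/
private theorem onesFn_eqH (u : List Bool) : onesFn u = ones u.length := unaryEncodeNat_eq_replicate _
/-- `ones a = [] ↔ a = 0`. [folklore] -/
private theorem ones_eq_nilH (a : ℕ) : (ones a = []) ↔ a = 0 := by
  rw [ones, List.replicate_eq_nil_iff]
/-- The head of a suffix is an indexed read. [folklore] -/
private theorem headD_dropH (l : List Bool) (k : ℕ) : (l.drop k).headD false = l.getD k false := by
  rw [List.headD_eq_head?_getD, List.head?_drop, List.getD_eq_getElem?_getD]

end Helpers

/-! ### Values of the top-level bricks -/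

section Values

variable (inp r : List Bool)

/-- `d1F`. [folklore] -/
theorem d1F_apply : S.d1F (boolPair inp r) =
    boolPair (ones (r.length / S.t (fstF inp).length)) (ones (S.posOf (fstF inp).length r.length)) := by
  simp only [d1F, quF, qLU, Function.comp_apply, fanoutFn_apply, fstF_boolPair, sndF_boolPair, tU_apply, onesFn_eqH,
    divModFn_boolPair, posOf]

/-- `qposU`. [folklore] -/
theorem qposU_apply : S.qposU (boolPair inp r) = ones (S.posOf (fstF inp).length r.length) := by
  rw [qposU, Function.comp_apply, d1F_apply, sndF_boolPair]

/-- `d2F`. [folklore] -/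
theorem d2F_apply : S.d2F (boolPair inp r) =
    boolPair (ones (r.length / S.t (fstF inp).length / (S.J (fstF inp).length + 1)))
      (ones (S.rhoOfH (fstF inp).length r.length)) := by
  simp only [d2F, quF, Function.comp_apply, fanoutFn_apply, fstF_boolPair, d1F_apply, L0U_apply, divModFn_boolPair,
    rhoOfH, L0]

/-- `qrhoU`. [folklore] -/
theorem qrhoU_apply : S.qrhoU (boolPair inp r) = ones (S.rhoOfH (fstF inp).length r.length) := by
  rw [qrhoU, Function.comp_apply, d2F_apply, sndF_boolPair]

/-- `L4U`. [folklore] -/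
theorem L4U_apply (u : List Bool) : S.L4U u = ones (4 * S.L0 u.length + 1) := by
  simp only [L4U, L0U_apply, ones_appendH, ones_append_trueH]
  congr 1; ring

/-- `d3F`. [folklore] -/
theorem d3F_apply : S.d3F (boolPair inp r) =
    boolPair (ones (S.QOf (fstF inp).length r.length)) (ones (S.jOfH (fstF inp).length r.length)) := by
  simp only [d3F, quF, Function.comp_apply, fanoutFn_apply, fstF_boolPair, d2F_apply, L4U_apply, divModFn_boolPair,
    QOf, jOfH]

/-- `qjU`. [folklore] -/
theorem qjU_apply : S.qjU (boolPair inp r) = ones (S.jOfH (fstF inp).length r.length) := by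
  rw [qjU, Function.comp_apply, d3F_apply, sndF_boolPair]

/-- `qQU`. [folklore] -/
theorem qQU_apply : S.qQU (boolPair inp r) = ones (S.QOf (fstF inp).length r.length) := by
  rw [qQU, Function.comp_apply, d3F_apply, fstF_boolPair]

/-- `idxHU`. [folklore] -/
theorem idxHU_apply : S.idxHU (boolPair inp r) =
    ones (S.idxOf (fstF inp).length (S.rhoOfH (fstF inp).length r.length) (S.jOfH (fstF inp).length r.length)) := by
  simp only [idxHU, quF, Function.comp_apply, fstF_boolPair, qrhoU_apply, qjU_apply, L0U_apply,
    HashBricks.umulFn_boolPair, ones_appendH, idxOf, L0]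

/-- The decoded `ρ` is within the bound. [folklore] -/
theorem rhoOfH_le (n L : ℕ) : S.rhoOfH n L ≤ S.J n := Nat.lt_succ_iff.1 (Nat.mod_lt _ (Nat.succ_pos _))

/-- The decoded `j` is within the bound. [folklore] -/
theorem jOfH_le (n L : ℕ) : S.jOfH n L ≤ 4 * S.L0 n := Nat.lt_succ_iff.1 (Nat.mod_lt _ (Nat.succ_pos _))

/-- `qm1U`. [folklore] -/
theorem qm1U_apply : S.qm1U (boolPair inp r) = ones (S.m1 (fstF inp).length (S.jOfH (fstF inp).length r.length)) := by
  rw [qm1U, Function.comp_apply, synF, fanoutFn_apply, fanoutFn_apply, m1U_apply, fstF_boolPair, sndF_boolPair,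
    fstF_boolPair, quF, Function.comp_apply, fstF_boolPair, idxHU_apply, length_onesH, S.jOf_idxOf (rhoOfH_le _ _)]

/-- `qm2U`. [folklore] -/
theorem qm2U_apply : S.qm2U (boolPair inp r) = ones (S.m2 (fstF inp).length (S.jOfH (fstF inp).length r.length)) := by
  rw [qm2U, Function.comp_apply, synF, fanoutFn_apply, fanoutFn_apply, m2U_apply, fstF_boolPair, sndF_boolPair,
    fstF_boolPair, quF, Function.comp_apply, fstF_boolPair, idxHU_apply, length_onesH, S.jOf_idxOf (rhoOfH_le _ _)]

/-- `rLenU`. [folklore] -/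
theorem rLenU_apply (u : List Bool) : S.rLenU u = ones (S.rLen u.length) := by
  simp only [rLenU, Function.comp_apply, fanoutFn_apply, tU_apply, L0U_apply, true_cons_onesH, HashBricks.umulFn_boolPair,
    rLen]

/-- `bodyU`. [folklore] -/
theorem bodyU_apply : S.bodyU (boolPair inp r) = ones (S.dhBody (fstF inp).length (S.jOfH (fstF inp).length r.length)) := by
  simp only [bodyU, quF, Function.comp_apply, fstF_boolPair, K1U_apply, K2U_apply, rLenU_apply, qm2U_apply, ones_appendH,
    true_cons_onesH, dhBody]
  congr 1; ring

/-- `qkapU`. [folklore] -/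
theorem qkapU_apply : S.qkapU (boolPair inp r) = ones (S.kapOfH (fstF inp).length r.length) := by
  rw [qkapU, Function.comp_apply, fanoutFn_apply, bodyU_apply, qQU_apply, drop_onesH, kapOfH]

/-- `dcoinsF`. [folklore] -/
theorem dcoinsF_apply : S.dcoinsF (boolPair inp r) =
    (r.drop (S.dhBody (fstF inp).length (S.jOfH (fstF inp).length r.length))).take (S.kapOfH (fstF inp).length r.length) := by
  rw [dcoinsF, Function.comp_apply, fanoutFn_apply, qkapU_apply, Function.comp_apply, fanoutFn_apply, bodyU_apply,
    sndF_boolPair, dropFn_boolPair, takeFn_boolPair, length_onesH, length_onesH]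

omit S in
/-- `r1HF`. [folklore] -/
theorem r1HF_apply : r1HF (boolPair inp r) = r.drop 1 := by
  rw [r1HF, Function.comp_apply, fanoutFn_apply, sndF_boolPair, dropFn_boolPair, List.length_singleton]

/-- `qk1F`. [folklore] -/
theorem qk1F_apply : S.qk1F (boolPair inp r) = (r.drop 1).take (S.K1 (fstF inp).length) := by
  rw [qk1F, Function.comp_apply, fanoutFn_apply, Function.comp_apply, quF, Function.comp_apply, fstF_boolPair, K1U_apply,
    r1HF_apply, takeFn_boolPair, length_onesH]

/-- `rest1F`. [folklore] -/
theorem rest1F_apply : S.rest1F (boolPair inp r) = (r.drop 1).drop (S.K1 (fstF inp).length) := by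
  rw [rest1F, Function.comp_apply, fanoutFn_apply, Function.comp_apply, quF, Function.comp_apply, fstF_boolPair, K1U_apply,
    r1HF_apply, dropFn_boolPair, length_onesH]

/-- `qk2F`. [folklore] -/
theorem qk2F_apply : S.qk2F (boolPair inp r) = ((r.drop 1).drop (S.K1 (fstF inp).length)).take (S.K2 (fstF inp).length) := by
  rw [qk2F, Function.comp_apply, fanoutFn_apply, Function.comp_apply, quF, Function.comp_apply, fstF_boolPair, K2U_apply,
    rest1F_apply, takeFn_boolPair, length_onesH]

/-- `rest2F`. [folklore] -/
theorem rest2F_apply : S.rest2F (boolPair inp r) = (r.drop 1).drop (S.K1 (fstF inp).length + S.K2 (fstF inp).length) := by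
  rw [rest2F, Function.comp_apply, fanoutFn_apply, Function.comp_apply, quF, Function.comp_apply, fstF_boolPair, K2U_apply,
    rest1F_apply, dropFn_boolPair, length_onesH, List.drop_drop]

/-- `qRF`. [folklore] -/
theorem qRF_apply : S.qRF (boolPair inp r) =
    ((r.drop 1).drop (S.K1 (fstF inp).length + S.K2 (fstF inp).length)).take (S.rLen (fstF inp).length) := by
  rw [qRF, Function.comp_apply, fanoutFn_apply, Function.comp_apply, quF, Function.comp_apply, fstF_boolPair, rLenU_apply,
    rest2F_apply, takeFn_boolPair, length_onesH]

/-- `qu2F`. [folklore] -/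
theorem qu2F_apply : S.qu2F (boolPair inp r) =
    ((r.drop 1).drop (S.K1 (fstF inp).length + S.K2 (fstF inp).length + S.rLen (fstF inp).length)).take
      (S.m2 (fstF inp).length (S.jOfH (fstF inp).length r.length)) := by
  rw [qu2F, Function.comp_apply, fanoutFn_apply, qm2U_apply, Function.comp_apply, fanoutFn_apply, Function.comp_apply, quF,
    Function.comp_apply, fstF_boolPair, rLenU_apply, rest2F_apply, dropFn_boolPair, takeFn_boolPair, length_onesH,
    length_onesH, List.drop_drop]

omit S in
/-- `cvF`. [folklore] -/
theorem cvF_apply : cvF (boolPair inp r) = sndF inp ++ [r.headD false] := by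
  simp only [cvF, qcF, qvF, Function.comp_apply, fstF_boolPair, sndF_boolPair, HashBricks.headBitFn_apply]

/-- `ctxHF`. [folklore] -/
theorem ctxHF_apply : S.ctxHF (boolPair inp r) =
    boolPair (boolPair (boolPair (ones (fstF inp).length) (ones (S.rhoOfH (fstF inp).length r.length)))
      (boolPair (ones (S.posOf (fstF inp).length r.length)) (sndF inp ++ [r.headD false])))
      (((r.drop 1).drop (S.K1 (fstF inp).length + S.K2 (fstF inp).length)).take (S.rLen (fstF inp).length)) := by
  simp only [ctxHF, Function.comp_apply, fanoutFn_apply, quF, fstF_boolPair, onesFn_eqH, qrhoU_apply, qposU_apply, cvF_apply,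
    qRF_apply]

end Values

/-! ### Values of the fold body -/

section Body

variable (n ρ pos ℓ : ℕ) (cv R : List Bool)

/-- The canonical body input. [folklore] -/
private abbrev zB : List Bool :=
  boolPair (boolPair (boolPair (boolPair (ones n) (ones ρ)) (boolPair (ones pos) cv)) R) (ones ℓ)

omit S in
/-- `hnU_Z`. [folklore] -/
private theorem hnU_Z : hnU (zB n ρ pos ℓ cv R) = ones n := by simp [hnU, zB]
omit S in
/-- `hrhoU_Z`. [folklore] -/
private theorem hrhoU_Z : hrhoU (zB n ρ pos ℓ cv R) = ones ρ := by simp [hrhoU, zB]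
omit S in
/-- `hposU_Z`. [folklore] -/
private theorem hposU_Z : hposU (zB n ρ pos ℓ cv R) = ones pos := by simp [hposU, zB]
omit S in
/-- `hcvF_Z`. [folklore] -/
private theorem hcvF_Z : hcvF (zB n ρ pos ℓ cv R) = cv := by simp [hcvF, zB]
omit S in
/-- `hRF_Z`. [folklore] -/
private theorem hRF_Z : hRF (zB n ρ pos ℓ cv R) = R := by simp [hRF, zB]
omit S in
/-- `hlU_Z`. [folklore] -/
private theorem hlU_Z : hlU (zB n ρ pos ℓ cv R) = ones ℓ := by simp [hlU, zB]

/-- `hL1U_Z`. [folklore] -/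
private theorem hL1U_Z : S.hL1U (zB n ρ pos ℓ cv R) = ones (S.L0 n + 1) := by
  rw [hL1U, Function.comp_apply, Function.comp_apply, hnU_Z, L0U_apply, length_onesH, true_cons_onesH]

/-- `hblkF_Z`. [folklore] -/
private theorem hblkF_Z : S.hblkF (zB n ρ pos ℓ cv R) = blk (S.L0 n + 1) ℓ R := by
  simp only [hblkF, Function.comp_apply, fanoutFn_apply, hL1U_Z, hlU_Z, hRF_Z, HashBricks.umulFn_boolPair, dropFn_boolPair,
    takeFn_boolPair, length_onesH, blk]

/-- `hbitF_Z`. [folklore] -/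
private theorem hbitF_Z : S.hbitF (zB n ρ pos ℓ cv R) = [(blk (S.L0 n + 1) ℓ R).headD false] := by
  rw [hbitF, Function.comp_apply, hblkF_Z, HashBricks.headBitFn_apply]

/-- `hcoinF_Z`. [folklore] -/
private theorem hcoinF_Z : S.hcoinF (zB n ρ pos ℓ cv R) = ((blk (S.L0 n + 1) ℓ R).drop 1).take ρ := by
  simp only [hcoinF, Function.comp_apply, fanoutFn_apply, hrhoU_Z, hblkF_Z, dropFn_boolPair, takeFn_boolPair, length_onesH,
    List.length_singleton]

/-- `hfreshF_Z`. [folklore] -/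
private theorem hfreshF_Z : S.hfreshF (zB n ρ pos ℓ cv R) = [(blk (S.L0 n + 1) ℓ R).getD (S.L0 n) false] := by
  rw [hfreshF, Function.comp_apply, Function.comp_apply, fanoutFn_apply, Function.comp_apply, hnU_Z, L0U_apply, length_onesH,
    hblkF_Z, dropFn_boolPair, length_onesH, HashBricks.headBitFn_apply, headD_dropH]

omit S in
/-- `hgeF_Z`. [folklore] -/
private theorem hgeF_Z : hgeF (zB n ρ pos ℓ cv R) = [decide (pos ≤ ℓ)] := by
  rw [hgeF, Function.comp_apply, Function.comp_apply, fanoutFn_apply, hlU_Z, hposU_Z, drop_onesH, isNilFn]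
  simp only [ones_eq_nilH, Nat.sub_eq_zero_iff_le]

omit S in
/-- `hleF_Z`. [folklore] -/
private theorem hleF_Z : hleF (zB n ρ pos ℓ cv R) = [decide (ℓ ≤ pos)] := by
  rw [hleF, Function.comp_apply, Function.comp_apply, fanoutFn_apply, hlU_Z, hposU_Z, drop_onesH, isNilFn]
  simp only [ones_eq_nilH, Nat.sub_eq_zero_iff_le]

/-- `hrevF_Z`. [folklore] -/
private theorem hrevF_Z : S.hrevF (zB n ρ pos ℓ cv R) =
    [if ℓ < pos then (blk (S.L0 n + 1) ℓ R).getD (S.L0 n) false else (blk (S.L0 n + 1) ℓ R).headD false] := by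
  rw [hrevF, iteFn_apply (hgeF_Z n ρ pos ℓ cv R), hbitF_Z, hfreshF_Z]
  by_cases h : ℓ < pos
  · rw [if_pos h, if_neg (by simp only [decide_eq_true_eq]; omega)]
  · rw [if_neg h, if_pos (by simp only [decide_eq_true_eq]; omega)]

/-- `hcomF_Z`. [folklore] -/
private theorem hcomF_Z : S.hcomF (zB n ρ pos ℓ cv R) =
    S.comRun n ((blk (S.L0 n + 1) ℓ R).headD false) (((blk (S.L0 n + 1) ℓ R).drop 1).take ρ) := by
  simp only [hcomF, Function.comp_apply, fanoutFn_apply, hnU_Z, hbitF_Z, hcoinF_Z, comB, fstF_boolPair, sndF_boolPair,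
    length_onesH, List.headD_cons, comRun]

/-- `hQcU_Z`. [folklore] -/
private theorem hQcU_Z : S.hQcU (zB n ρ pos ℓ cv R) = ones (S.Qc n) := by
  rw [hQcU, Function.comp_apply, hnU_Z, QcU_apply, length_onesH]

/-- **The body at a non-planted position computes the hybrid pair.** [cite: Goldreich2001, Thm. 3.2.6 (proof)] -/
theorem hpieceNF_Z : S.hpieceNF (zB n ρ pos ℓ cv R) = S.pieceP n ρ pos ℓ R := by
  simp only [hpieceNF, hhdrF, hbdyF, Function.comp_apply, fanoutFn_apply, hQcU_Z, hcomF_Z, hrevF_Z, takeFn_boolPair,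
    onesFn_eqH, Kannan.zerosFn_apply, ones, List.length_replicate, pieceP, encP]

/-- **The body computes the planted tuple's pieces.** [cite: Goldreich2001, Thm. 3.2.6 (proof, algorithm D')] -/
theorem hpieceF_Z : S.hpieceF (zB n ρ pos ℓ cv R) = if ℓ = pos then cv else S.pieceP n ρ pos ℓ R := by
  rw [hpieceF, iteFn_apply (hgeF_Z n ρ pos ℓ cv R), iteFn_apply (hleF_Z n ρ pos ℓ cv R), hcvF_Z, hpieceNF_Z]
  by_cases h : ℓ = pos
  · subst h; simp
  · rw [if_neg h]
    by_cases h' : pos ≤ ℓ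
    · rw [if_pos (decide_eq_true h'), if_neg (by simp only [decide_eq_true_eq]; omega)]
    · rw [if_neg (by simpa using h')]

end Body

/-! ### The program computes the reduction -/

section Program

variable (inp r : List Bool)

/-- A nested pair is at least as long as its right component. [folklore] -/
private theorem le_length_boolPair_right (a b : List Bool) : b.length ≤ (boolPair a b).length := by
  rw [length_boolPair]; omega

/-- A nested pair is at least as long as its left component. [folklore] -/
private theorem le_length_boolPair_left (a b : List Bool) : a.length ≤ (boolPair a b).length := by
  rw [length_boolPair]; omega

/-- **The fold computes the planted tuple.** [cite: Goldreich2001, Thm. 3.2.6 (proof, algorithm D')] -/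
theorem zPlantF_apply : S.zPlantF (boolPair inp r) =
    S.zPlant (fstF inp).length (S.rhoOfH (fstF inp).length r.length) (S.posOf (fstF inp).length r.length)
      (sndF inp ++ [r.headD false])
      (((r.drop 1).drop (S.K1 (fstF inp).length + S.K2 (fstF inp).length)).take (S.rLen (fstF inp).length)) := by
  rw [zPlantF, Function.comp_apply, fanoutFn_apply, ctxHF_apply, Function.comp_apply, quF, Function.comp_apply, fstF_boolPair,
    tU_apply]
  generalize (fstF inp).length = n
  generalize sndF inp ++ [r.headD false] = cv
  generalize ((r.drop 1).drop (S.K1 n + S.K2 n)).take (S.rLen n) = R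
  generalize S.rhoOfH n r.length = ρ
  generalize S.posOf n r.length = pos
  have hn : n ≤ (boolPair (boolPair (boolPair (ones n) (ones ρ)) (boolPair (ones pos) cv)) R).length :=
    (length_onesH n).ge.trans ((le_length_boolPair_left _ _).trans ((le_length_boolPair_left _ _).trans
      (le_length_boolPair_left _ _)))
  have hcv : cv.length ≤ (boolPair (boolPair (boolPair (ones n) (ones ρ)) (boolPair (ones pos) cv)) R).length :=
    (le_length_boolPair_right (ones pos) cv).trans ((le_length_boolPair_right _ _).trans (le_length_boolPair_left _ _))
  rw [foldCat_apply, zPlant, length_onesH]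
  · exact ccat_congr fun ℓ _ => hpieceF_Z (S := S) n ρ pos ℓ cv R
  · rw [length_onesH, tP_eval]; exact t_mono hn
  · intro ℓ _
    rw [hpieceF_Z (S := S) n ρ pos ℓ cv R, eval_add, eval_X, LzP_eval]
    by_cases h : ℓ = pos
    · rw [if_pos h]; exact hcv.trans (Nat.le_add_right _ _)
    · rw [if_neg h, pieceP, length_encP]; exact (Lz_mono hn).trans (Nat.le_add_left _ _)

/-- `qh1F`. [folklore] -/
theorem qh1F_apply : S.qh1F (boolPair inp r) =
    hashStr (S.t (fstF inp).length * S.Lz (fstF inp).length) (S.m1 (fstF inp).length (S.jOfH (fstF inp).length r.length))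
      ((r.drop 1).take (S.K1 (fstF inp).length))
      (S.zPlant (fstF inp).length (S.rhoOfH (fstF inp).length r.length) (S.posOf (fstF inp).length r.length)
        (sndF inp ++ [r.headD false])
        (((r.drop 1).drop (S.K1 (fstF inp).length + S.K2 (fstF inp).length)).take (S.rLen (fstF inp).length))) := by
  rw [qh1F, Function.comp_apply, fanoutFn_apply, fanoutFn_apply, fanoutFn_apply, Function.comp_apply, quF, Function.comp_apply,
    fstF_boolPair, tLzU_apply, qm1U_apply, qk1F_apply, zPlantF_apply, AffineProg.hashFn_boolPair]

/-- **The program computes the sample handed to `D`.** [cite: Luby1996, Lecture 10, Theorem 10.3 (proof, Step 2)] -/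
theorem sampleF_apply : S.sampleF (boolPair inp r) =
    S.dhSample (fstF inp).length (S.rhoOfH (fstF inp).length r.length) (S.posOf (fstF inp).length r.length)
      (S.jOfH (fstF inp).length r.length) (sndF inp) r := by
  rw [sampleF, qpayF, Function.comp_apply, fanoutFn_apply, takeFn_boolPair, qk1F_apply, qk2F_apply, qh1F_apply, qu2F_apply]
  simp only [xL1U, Function.comp_apply, quF, fstF_boolPair, xLenU_apply, Kannan.zerosFn_apply, List.length_cons, length_onesH,
    dhSample, pay, List.append_assoc]

/-- `dOutF`. [folklore] -/
theorem dOutF_apply (D : RandAlg (List Bool) Bool) : S.dOutF D (boolPair inp r) =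
    encodeBool (D.run (boolPair (fstF inp) (S.dhSample (fstF inp).length (S.rhoOfH (fstF inp).length r.length)
      (S.posOf (fstF inp).length r.length) (S.jOfH (fstF inp).length r.length) (sndF inp) r))
      ((r.drop (S.dhBody (fstF inp).length (S.jOfH (fstF inp).length r.length))).take (S.kapOfH (fstF inp).length r.length))) := by
  rw [dOutF, Function.comp_apply, dInF, fanoutFn_apply, fanoutFn_apply, fstF_boolPair, sndF_boolPair, sampleF_apply,
    dcoinsF_apply, quF, Function.comp_apply, fstF_boolPair]

/-- **The program computes the run function of the reduction** on every input.
[cite: Goldreich2001, Thm. 3.2.6 (proof, algorithm D'); Luby1996, Lecture 10, Theorem 10.3 (proof, Step 2)] -/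
theorem dhF_boolPair (D : RandAlg (List Bool) Bool) : S.dhF D (boolPair inp r) = encodeBool (S.dhRun D inp r) := by
  have hb : ∀ b : Bool, encodeBool b = [b] := fun b => by cases b <;> rfl
  have hv : qvF (boolPair inp r) = [r.headD false] := by
    rw [qvF, Function.comp_apply, sndF_boolPair, HashBricks.headBitFn_apply]
  rw [dhF, HashBricks.xorFn_apply ((dOutF_apply inp r D).trans (hb _)) hv, hb, dhRun]
  rfl

end Program

/-! ### The program is polynomial-time -/

section FP

omit S in
/-- `quF_mem_FP`. [folklore] -/
theorem quF_mem_FP : quF ∈ FP := comp_mem_FP fstF_mem_FP fstF_mem_FP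
omit S in
/-- `qcF_mem_FP` (private: the same plumbing fact exists as `ForrMem.qcF_mem_FP` in an unrelated area). [folklore] -/
private theorem qcF_mem_FP : qcF ∈ FP := comp_mem_FP sndF_mem_FP fstF_mem_FP
omit S in
/-- `qvF_mem_FP`. [folklore] -/
theorem qvF_mem_FP : qvF ∈ FP := comp_mem_FP HashBricks.headBitFn_mem_FP sndF_mem_FP
omit S in
/-- `qLU_mem_FP`. [folklore] -/
theorem qLU_mem_FP : qLU ∈ FP := comp_mem_FP onesFn_mem_FP sndF_mem_FP
/-- `d1F_mem_FP`. [folklore] -/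
theorem d1F_mem_FP : S.d1F ∈ FP := comp_mem_FP divModFn_mem_FP (fanoutFn_mem_FP (comp_mem_FP tU_mem_FP quF_mem_FP) qLU_mem_FP)
/-- `qposU_mem_FP`. [folklore] -/
theorem qposU_mem_FP : S.qposU ∈ FP := comp_mem_FP sndF_mem_FP d1F_mem_FP
/-- `d2F_mem_FP`. [folklore] -/
theorem d2F_mem_FP : S.d2F ∈ FP :=
  comp_mem_FP divModFn_mem_FP (fanoutFn_mem_FP (comp_mem_FP L0U_mem_FP quF_mem_FP) (comp_mem_FP fstF_mem_FP d1F_mem_FP))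
/-- `qrhoU_mem_FP`. [folklore] -/
theorem qrhoU_mem_FP : S.qrhoU ∈ FP := comp_mem_FP sndF_mem_FP d2F_mem_FP
/-- `L4U_mem_FP`. [folklore] -/
theorem L4U_mem_FP : S.L4U ∈ FP :=
  (append_mem_FP L0U_mem_FP (append_mem_FP L0U_mem_FP (append_mem_FP L0U_mem_FP (append_mem_FP L0U_mem_FP (const_mem_FP _)))) :)
/-- `d3F_mem_FP`. [folklore] -/
theorem d3F_mem_FP : S.d3F ∈ FP :=
  comp_mem_FP divModFn_mem_FP (fanoutFn_mem_FP (comp_mem_FP L4U_mem_FP quF_mem_FP) (comp_mem_FP fstF_mem_FP d2F_mem_FP))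
/-- `qjU_mem_FP`. [folklore] -/
theorem qjU_mem_FP : S.qjU ∈ FP := comp_mem_FP sndF_mem_FP d3F_mem_FP
/-- `qQU_mem_FP`. [folklore] -/
theorem qQU_mem_FP : S.qQU ∈ FP := comp_mem_FP fstF_mem_FP d3F_mem_FP
/-- `idxHU_mem_FP`. [folklore] -/
theorem idxHU_mem_FP : S.idxHU ∈ FP :=
  (append_mem_FP qrhoU_mem_FP (comp_mem_FP HashBricks.umulFn_mem_FP (pair_mem_FP (comp_mem_FP L0U_mem_FP quF_mem_FP) qjU_mem_FP)) :)
/-- `synF_mem_FP`. [folklore] -/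
theorem synF_mem_FP : S.synF ∈ FP := fanoutFn_mem_FP quF_mem_FP (fanoutFn_mem_FP idxHU_mem_FP (const_mem_FP _))
/-- `qm1U_mem_FP`. [folklore] -/
theorem qm1U_mem_FP : S.qm1U ∈ FP := comp_mem_FP m1U_mem_FP synF_mem_FP
/-- `qm2U_mem_FP`. [folklore] -/
theorem qm2U_mem_FP : S.qm2U ∈ FP := comp_mem_FP m2U_mem_FP synF_mem_FP
/-- `rLenU_mem_FP`. [folklore] -/
theorem rLenU_mem_FP : S.rLenU ∈ FP :=
  comp_mem_FP HashBricks.umulFn_mem_FP (fanoutFn_mem_FP tU_mem_FP (comp_mem_FP (cons_mem_FP true) L0U_mem_FP))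
/-- `bodyU_mem_FP`. [folklore] -/
theorem bodyU_mem_FP : S.bodyU ∈ FP :=
  (comp_mem_FP (cons_mem_FP true) (append_mem_FP (comp_mem_FP K1U_mem_FP quF_mem_FP) (append_mem_FP (comp_mem_FP K2U_mem_FP quF_mem_FP)
    (append_mem_FP (comp_mem_FP rLenU_mem_FP quF_mem_FP) qm2U_mem_FP))) :)
/-- `qkapU_mem_FP`. [folklore] -/
theorem qkapU_mem_FP : S.qkapU ∈ FP := comp_mem_FP dropFn_mem_FP (fanoutFn_mem_FP bodyU_mem_FP qQU_mem_FP)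
/-- `dcoinsF_mem_FP`. [folklore] -/
theorem dcoinsF_mem_FP : S.dcoinsF ∈ FP :=
  comp_mem_FP takeFn_mem_FP (fanoutFn_mem_FP qkapU_mem_FP (comp_mem_FP dropFn_mem_FP (fanoutFn_mem_FP bodyU_mem_FP sndF_mem_FP)))
omit S in
/-- `r1HF_mem_FP`. [folklore] -/
theorem r1HF_mem_FP : r1HF ∈ FP := comp_mem_FP dropFn_mem_FP (fanoutFn_mem_FP (const_mem_FP _) sndF_mem_FP)
/-- `qk1F_mem_FP`. [folklore] -/
theorem qk1F_mem_FP : S.qk1F ∈ FP := comp_mem_FP takeFn_mem_FP (fanoutFn_mem_FP (comp_mem_FP K1U_mem_FP quF_mem_FP) r1HF_mem_FP)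
/-- `rest1F_mem_FP`. [folklore] -/
theorem rest1F_mem_FP : S.rest1F ∈ FP := comp_mem_FP dropFn_mem_FP (fanoutFn_mem_FP (comp_mem_FP K1U_mem_FP quF_mem_FP) r1HF_mem_FP)
/-- `qk2F_mem_FP`. [folklore] -/
theorem qk2F_mem_FP : S.qk2F ∈ FP := comp_mem_FP takeFn_mem_FP (fanoutFn_mem_FP (comp_mem_FP K2U_mem_FP quF_mem_FP) rest1F_mem_FP)
/-- `rest2F_mem_FP`. [folklore] -/
theorem rest2F_mem_FP : S.rest2F ∈ FP := comp_mem_FP dropFn_mem_FP (fanoutFn_mem_FP (comp_mem_FP K2U_mem_FP quF_mem_FP) rest1F_mem_FP)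
/-- `qRF_mem_FP`. [folklore] -/
theorem qRF_mem_FP : S.qRF ∈ FP := comp_mem_FP takeFn_mem_FP (fanoutFn_mem_FP (comp_mem_FP rLenU_mem_FP quF_mem_FP) rest2F_mem_FP)
/-- `qu2F_mem_FP`. [folklore] -/
theorem qu2F_mem_FP : S.qu2F ∈ FP :=
  comp_mem_FP takeFn_mem_FP (fanoutFn_mem_FP qm2U_mem_FP (comp_mem_FP dropFn_mem_FP
    (fanoutFn_mem_FP (comp_mem_FP rLenU_mem_FP quF_mem_FP) rest2F_mem_FP)))
omit S in
/-- `cvF_mem_FP`. [folklore] -/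
theorem cvF_mem_FP : cvF ∈ FP := (append_mem_FP qcF_mem_FP qvF_mem_FP :)
/-- `ctxHF_mem_FP`. [folklore] -/
theorem ctxHF_mem_FP : S.ctxHF ∈ FP :=
  fanoutFn_mem_FP (fanoutFn_mem_FP (fanoutFn_mem_FP (comp_mem_FP onesFn_mem_FP quF_mem_FP) qrhoU_mem_FP)
    (fanoutFn_mem_FP qposU_mem_FP cvF_mem_FP)) qRF_mem_FP
omit S in
/-- `hnU_mem_FP`. [folklore] -/
theorem hnU_mem_FP : hnU ∈ FP := comp_mem_FP fstF_mem_FP (comp_mem_FP fstF_mem_FP (comp_mem_FP fstF_mem_FP fstF_mem_FP))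
omit S in
/-- `hrhoU_mem_FP`. [folklore] -/
theorem hrhoU_mem_FP : hrhoU ∈ FP := comp_mem_FP sndF_mem_FP (comp_mem_FP fstF_mem_FP (comp_mem_FP fstF_mem_FP fstF_mem_FP))
omit S in
/-- `hposU_mem_FP`. [folklore] -/
theorem hposU_mem_FP : hposU ∈ FP := comp_mem_FP fstF_mem_FP (comp_mem_FP sndF_mem_FP (comp_mem_FP fstF_mem_FP fstF_mem_FP))
omit S in
/-- `hcvF_mem_FP`. [folklore] -/
theorem hcvF_mem_FP : hcvF ∈ FP := comp_mem_FP sndF_mem_FP (comp_mem_FP sndF_mem_FP (comp_mem_FP fstF_mem_FP fstF_mem_FP))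
omit S in
/-- `hRF_mem_FP`. [folklore] -/
theorem hRF_mem_FP : hRF ∈ FP := comp_mem_FP sndF_mem_FP fstF_mem_FP
omit S in
/-- `hlU_mem_FP`. [folklore] -/
theorem hlU_mem_FP : hlU ∈ FP := sndF_mem_FP
/-- `hL1U_mem_FP`. [folklore] -/
theorem hL1U_mem_FP : S.hL1U ∈ FP := comp_mem_FP (cons_mem_FP true) (comp_mem_FP L0U_mem_FP hnU_mem_FP)
/-- `hblkF_mem_FP`. [folklore] -/
theorem hblkF_mem_FP : S.hblkF ∈ FP :=
  comp_mem_FP takeFn_mem_FP (fanoutFn_mem_FP hL1U_mem_FP (comp_mem_FP dropFn_mem_FP (fanoutFn_mem_FP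
    (comp_mem_FP HashBricks.umulFn_mem_FP (fanoutFn_mem_FP hlU_mem_FP hL1U_mem_FP)) hRF_mem_FP)))
/-- `hbitF_mem_FP`. [folklore] -/
theorem hbitF_mem_FP : S.hbitF ∈ FP := comp_mem_FP HashBricks.headBitFn_mem_FP hblkF_mem_FP
/-- `hcoinF_mem_FP`. [folklore] -/
theorem hcoinF_mem_FP : S.hcoinF ∈ FP :=
  comp_mem_FP takeFn_mem_FP (fanoutFn_mem_FP hrhoU_mem_FP (comp_mem_FP dropFn_mem_FP (fanoutFn_mem_FP (const_mem_FP _) hblkF_mem_FP)))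
/-- `hfreshF_mem_FP`. [folklore] -/
theorem hfreshF_mem_FP : S.hfreshF ∈ FP :=
  comp_mem_FP HashBricks.headBitFn_mem_FP (comp_mem_FP dropFn_mem_FP (fanoutFn_mem_FP (comp_mem_FP L0U_mem_FP hnU_mem_FP) hblkF_mem_FP))
omit S in
/-- `hgeF_mem_FP`. [folklore] -/
theorem hgeF_mem_FP : hgeF ∈ FP := comp_mem_FP isNilFn_mem_FP (comp_mem_FP dropFn_mem_FP (fanoutFn_mem_FP hlU_mem_FP hposU_mem_FP))
omit S in
/-- `hleF_mem_FP`. [folklore] -/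
theorem hleF_mem_FP : hleF ∈ FP := comp_mem_FP isNilFn_mem_FP (comp_mem_FP dropFn_mem_FP (fanoutFn_mem_FP hposU_mem_FP hlU_mem_FP))
/-- `hrevF_mem_FP`. [folklore] -/
theorem hrevF_mem_FP : S.hrevF ∈ FP := iteFn_mem_FP hgeF_mem_FP hbitF_mem_FP hfreshF_mem_FP
/-- `hcomF_mem_FP`. [folklore] -/
theorem hcomF_mem_FP (hS : S.WF) : S.hcomF ∈ FP :=
  comp_mem_FP hS.hcom (fanoutFn_mem_FP hnU_mem_FP (fanoutFn_mem_FP hbitF_mem_FP hcoinF_mem_FP))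
/-- `hQcU_mem_FP`. [folklore] -/
theorem hQcU_mem_FP : S.hQcU ∈ FP := comp_mem_FP QcU_mem_FP hnU_mem_FP
/-- `hhdrF_mem_FP`. [folklore] -/
theorem hhdrF_mem_FP (hS : S.WF) : S.hhdrF ∈ FP :=
  (comp_mem_FP takeFn_mem_FP (fanoutFn_mem_FP hQcU_mem_FP (append_mem_FP (comp_mem_FP onesFn_mem_FP (hcomF_mem_FP hS))
    (comp_mem_FP Kannan.zerosFn_mem_FP hQcU_mem_FP))) :)
/-- `hbdyF_mem_FP`. [folklore] -/
theorem hbdyF_mem_FP (hS : S.WF) : S.hbdyF ∈ FP :=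
  (comp_mem_FP takeFn_mem_FP (fanoutFn_mem_FP hQcU_mem_FP (append_mem_FP (hcomF_mem_FP hS)
    (comp_mem_FP Kannan.zerosFn_mem_FP hQcU_mem_FP))) :)
/-- `hpieceNF_mem_FP`. [folklore] -/
theorem hpieceNF_mem_FP (hS : S.WF) : S.hpieceNF ∈ FP :=
  (append_mem_FP (hhdrF_mem_FP hS) (append_mem_FP (hbdyF_mem_FP hS) hrevF_mem_FP) :)
/-- `hpieceF_mem_FP`. [folklore] -/
theorem hpieceF_mem_FP (hS : S.WF) : S.hpieceF ∈ FP :=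
  iteFn_mem_FP hgeF_mem_FP (iteFn_mem_FP hleF_mem_FP hcvF_mem_FP (hpieceNF_mem_FP hS)) (hpieceNF_mem_FP hS)
/-- `zPlantF_mem_FP`. [folklore] -/
theorem zPlantF_mem_FP (hS : S.WF) : S.zPlantF ∈ FP :=
  comp_mem_FP (foldCat_mem_FP _ _ (hpieceF_mem_FP hS)) (fanoutFn_mem_FP ctxHF_mem_FP (comp_mem_FP tU_mem_FP quF_mem_FP))
/-- `qh1F_mem_FP`. [folklore] -/
theorem qh1F_mem_FP (hS : S.WF) : S.qh1F ∈ FP :=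
  comp_mem_FP AffineProg.hashFn_mem_FP (fanoutFn_mem_FP (fanoutFn_mem_FP (comp_mem_FP tLzU_mem_FP quF_mem_FP) qm1U_mem_FP)
    (fanoutFn_mem_FP qk1F_mem_FP (zPlantF_mem_FP hS)))
/-- `xL1U_mem_FP`. [folklore] -/
theorem xL1U_mem_FP : S.xL1U ∈ FP := comp_mem_FP (cons_mem_FP true) (comp_mem_FP xLenU_mem_FP quF_mem_FP)
/-- `qpayF_mem_FP`. [folklore] -/
theorem qpayF_mem_FP (hS : S.WF) : S.qpayF ∈ FP :=
  (comp_mem_FP takeFn_mem_FP (fanoutFn_mem_FP xL1U_mem_FP (append_mem_FP (qh1F_mem_FP hS) (append_mem_FP qu2F_mem_FP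
    (comp_mem_FP Kannan.zerosFn_mem_FP xL1U_mem_FP)))) :)
/-- `sampleF_mem_FP`. [folklore] -/
theorem sampleF_mem_FP (hS : S.WF) : S.sampleF ∈ FP :=
  (append_mem_FP qk1F_mem_FP (append_mem_FP qk2F_mem_FP (qpayF_mem_FP hS)) :)
/-- `dInF_mem_FP`. [folklore] -/
theorem dInF_mem_FP (hS : S.WF) : S.dInF ∈ FP := fanoutFn_mem_FP (fanoutFn_mem_FP quF_mem_FP (sampleF_mem_FP hS)) dcoinsF_mem_FP
/-- `dOutF_mem_FP`: `D`'s machine after the program. [cite: Goldreich2001, Thm. 3.2.6 (proof: "Clearly, D' can be implemented in probabilistic polynomial time")] -/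
theorem dOutF_mem_FP {D : RandAlg (List Bool) Bool} (hD : IsPPT D encodeBool) (hS : S.WF) : S.dOutF D ∈ FP :=
  comp_mem_FP (Hybrid.distFn_mem_FP hD) (dInF_mem_FP hS)
/-- **The program of the reduction is in `FP`.** [cite: Goldreich2001, Thm. 3.2.6 (proof); AroraBarak2009, §1.3] -/
theorem dhF_mem_FP {D : RandAlg (List Bool) Bool} (hD : IsPPT D encodeBool) (hS : S.WF) : S.dhF D ∈ FP :=
  HashBricks.xorFn_mem_FP (dOutF_mem_FP hD hS) qvF_mem_FP

/-- **The reduction is PPT** for a PPT `D` and a polynomially bounded coin budget.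
[cite: Goldreich2001, Thm. 3.2.6 (proof: "Clearly, D' can be implemented in probabilistic polynomial time")] -/
theorem isPPT_DH {D : RandAlg (List Bool) Bool} (hD : IsPPT D encodeBool) (hS : S.WF) {cl : ℕ → ℕ}
    (hcl : ∃ pc : Polynomial ℕ, ∀ L, cl L ≤ pc.eval L) : IsPPT (S.DH D cl) encodeBool := by
  refine ⟨?_, hcl⟩
  exact PolyTimeComputable.of_encode_eq (f := S.dhF D) (fun p : List Bool × List Bool => boolPair p.1 p.2) (fun _ => rfl)
    (fun p => dhF_boolPair p.1 p.2 D) (dhF_mem_FP hD hS)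

end FP

/-! ### The coin budget is polynomially bounded -/

section Budget

/-- `n ≤ lenH n`. [folklore] -/
theorem le_lenH (n : ℕ) : n ≤ S.lenH n := by unfold lenH; omega

/-- `J + 1 ≤ mCnt`, `4 L0 + 1 ≤ mCnt`, `L0 + 1 ≤ mCnt`. [folklore] -/
theorem mCnt_bounds (n : ℕ) : S.J n + 1 ≤ S.mCnt n ∧ 4 * S.L0 n + 1 ≤ S.mCnt n ∧ S.L0 n + 1 ≤ S.mCnt n := by
  unfold mCnt L0
  refine ⟨?_, ?_, ?_⟩
  · calc S.J n + 1 = (S.J n + 1) * 1 := (mul_one _).symm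
      _ ≤ _ := Nat.mul_le_mul_left _ (by omega)
  · calc 4 * (S.J n + 1) + 1 = 1 * (4 * (S.J n + 1) + 1) := (one_mul _).symm
      _ ≤ _ := Nat.mul_le_mul_right _ (by omega)
  · calc S.J n + 1 + 1 ≤ (S.J n + 1) * 2 := by omega
      _ ≤ _ := Nat.mul_le_mul_left _ (by omega)

/-- `packH ≤ t (1 + m)² (1 + Q)` with `m = mCnt`. [folklore] -/
theorem packH_le {n pos ρ j : ℕ} (hpos : pos < S.t n) (hρ : ρ ≤ S.J n) (hj : j ≤ 4 * S.L0 n) (Q : ℕ) :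
    S.packH n pos ρ j Q ≤ S.t n * (1 + S.mCnt n) ^ 2 * (1 + Q) := by
  obtain ⟨h1, h2, _⟩ := S.mCnt_bounds n
  unfold packH
  have hm : ρ + (S.J n + 1) * (j + (4 * S.L0 n + 1) * Q) ≤ S.mCnt n + S.mCnt n * (S.mCnt n + S.mCnt n * Q) := by
    have : (S.J n + 1) * (j + (4 * S.L0 n + 1) * Q) ≤ S.mCnt n * (S.mCnt n + S.mCnt n * Q) :=
      Nat.mul_le_mul h1 (Nat.add_le_add (hj.trans (by omega)) (Nat.mul_le_mul_right _ h2))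
    omega
  calc pos + S.t n * (ρ + (S.J n + 1) * (j + (4 * S.L0 n + 1) * Q))
      ≤ S.t n + S.t n * (S.mCnt n + S.mCnt n * (S.mCnt n + S.mCnt n * Q)) := Nat.add_le_add hpos.le (Nat.mul_le_mul_left _ hm)
    _ = S.t n * (1 + S.mCnt n + S.mCnt n ^ 2 + S.mCnt n ^ 2 * Q) := by ring
    _ ≤ S.t n * ((1 + S.mCnt n) ^ 2 * (1 + Q)) := Nat.mul_le_mul_left _ (by nlinarith [Nat.zero_le (S.mCnt n), Nat.zero_le Q])
    _ = _ := by ring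

/-- `dhBody n j ≤ 1 + a n + t n · mCnt n`. [folklore] -/
theorem dhBody_le (n j : ℕ) : S.dhBody n j ≤ 1 + S.a n + S.t n * S.mCnt n := by
  obtain ⟨_, _, h3⟩ := S.mCnt_bounds n
  have hm2 : S.m2 n j ≤ S.xLen n := by unfold m2; omega
  have hr : S.rLen n ≤ S.t n * S.mCnt n := Nat.mul_le_mul_left _ h3
  unfold dhBody a K1 K2
  nlinarith [hm2, hr, Nat.zero_le (S.M1 n * (S.t n * S.Lz n + 1)), Nat.zero_le (S.xLen n * (S.xLen n + 1))]

/-- **The coin budget of the reduction is polynomially bounded** (for a PPT `D`).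
[cite: Goldreich2001, Thm. 3.2.6 (proof), §1.3.2] -/
theorem clH_le {D : RandAlg (List Bool) Bool} (hD : IsPPT D encodeBool) (hS : S.WF) :
    ∃ pc : Polynomial ℕ, ∀ L, S.clH D L ≤ pc.eval L := by
  obtain ⟨qD, hqD⟩ := hD.2
  refine ⟨S.tP * (1 + S.mP) ^ 2 * (2 + S.aP + S.tP * S.mP + qD.comp (2 * Polynomial.X + 3 + S.aP)), fun L => ?_⟩
  by_cases h : ∃ n, S.lenH n = L
  · obtain ⟨n, rfl⟩ := h
    obtain ⟨hlt, _⟩ := posStar_spec (S := S) D n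
    have hn : n ≤ S.lenH n := S.le_lenH n
    have hκ : S.κD D n ≤ qD.eval (2 * S.lenH n + 3 + S.aP.eval (S.lenH n)) := by
      refine (hqD _).trans (TM2Iter.eval_mono _ ?_)
      have : S.aP.eval n ≤ S.aP.eval (S.lenH n) := TM2Iter.eval_mono _ hn
      rw [aP_eval] at this; omega
    have ht : S.t n ≤ S.tP.eval (S.lenH n) := by rw [← tP_eval]; exact TM2Iter.eval_mono _ hn
    have hm : S.mCnt n ≤ S.mP.eval (S.lenH n) := by rw [← mP_eval]; exact TM2Iter.eval_mono _ hn
    have ha : S.a n ≤ S.aP.eval (S.lenH n) := by rw [← aP_eval]; exact TM2Iter.eval_mono _ hn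
    have htm : S.t n * S.mCnt n ≤ S.tP.eval (S.lenH n) * S.mP.eval (S.lenH n) := Nat.mul_le_mul ht hm
    have hbody := S.dhBody_le n (S.jStar n)
    have hQ : 1 + (S.dhBody n (S.jStar n) + S.κD D n) ≤ 2 + S.aP.eval (S.lenH n) +
        S.tP.eval (S.lenH n) * S.mP.eval (S.lenH n) + qD.eval (2 * S.lenH n + 3 + S.aP.eval (S.lenH n)) := by omega
    rw [clH_lenH]
    refine (S.packH_le hlt (S.ρ_le_J hS n) (S.jStar_le n) _).trans ?_
    simp only [eval_mul, eval_pow, eval_add, eval_one, eval_ofNat, eval_comp, eval_X]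
    exact Nat.mul_le_mul (Nat.mul_le_mul ht (Nat.pow_le_pow_left (by omega) 2)) hQ
  · rw [clH, dif_neg h]; exact Nat.zero_le _

/-- **The reduction with its budget is PPT.** [cite: Goldreich2001, Thm. 3.2.6 (proof)] -/
theorem isPPT_DH_clH {D : RandAlg (List Bool) Bool} (hD : IsPPT D encodeBool) (hS : S.WF) : IsPPT (S.DH D (S.clH D)) encodeBool :=
  S.isPPT_DH hD hS (S.clH_le hD hS)

/-- **Step 2 of Luby's Theorem 10.3 for the commitment's false-entropy generator, unconditionally in the
reduction**: for a computationally hiding scheme the extreme hybrids `X S 0` and `X S t` are computationally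
indistinguishable. [cite: Luby1996, Lecture 10, Theorem 10.3 (proof, Step 2); Goldreich2001, Thm. 3.2.6, Def. 4.4.1 (1)] -/
theorem isCompIndistinguishable_hybrids (hS : S.WF) (hhid : S.C.IsComputationallyHiding) :
    IsCompIndistinguishable (S.X fun _ => 0) (S.X S.t) :=
  isCompIndistinguishable_X hS hhid fun _ hD => S.isPPT_DH_clH hD hS

end Budget

end Setup

end ComPRG

end Literature.Computability.Cryptography
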